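import Literature.AlgebraicGeometry.Resolution.AffineBlowupAlgebra
import Literature.AlgebraicGeometry.Resolution.BlowupAlgebraStrictTransform
import Mathlib.RingTheory.MvPolynomial.Basic
import HarnessLib

/-!
# The chart ring of the blowing up of the generic hypersurface section

Support file for crux stmt-ResolutionOfSingularities-15960
(`SectionAscent.FibrewiseClosedPoints`, line `registered`, stub `stub_certificateRegular`).

Abstract setting (instantiated with `B = K(t) ⊗_K A`, `B' = B/(ℓ)` in the stub file): ring maps
`ι : A → B`, `τ : K[t₁, …, t_s] → B`, a surjection `q : B → B'` with kernel `(ℓ)`,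
`ℓ = Σ τ(t_j) ι(g_j)` the GENERIC MEMBER of the linear system spanned by `g₁, …, g_s ∈ A`, an
ideal `I ∋ a` of `A`, and the ring map `χ : (A[It])_{(at)}[t] → B[IB/ι(a)]` of
`…CertificateRegularBaseChange` (here a variable with its two values and its two proved
properties — injectivity and generation — as hypotheses). The chart ring `B'[IB'/φ(a)]`
(`φ = q ∘ ι`) of `Bl_{IB'}(Spec B')`, the blowing up of the generic hypersurface section, is a
quotient of `B[IB/ι(a)]` (tree: `blowupAlgebraMap_surjective`; kernel = the `ι(a)`-saturation of
`(ℓ)`, `mem_ker_blowupAlgebraMap_iff`). For the composite `θ : (A[It])_{(at)}[t] → B'[IB'/φ(a)]`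
we prove generation (`exists_mul_sectionChartMap_eq`), `θ(ℓ₀) = 0` for `ℓ₀ = Σ (g_j/1) t_j`,
`θ(a/1)` is a non-zero-divisor, and **the kernel** (`exists_eq_of_sectionChartMap_eq_zero`): if
`θ(d) = 0` then `(a/1)^N · d · σ = ℓ₀ · d''` for some `N`, `0 ≠ σ ∈ K[t]`, `d''`. The same facts
are transported to the `Proj`-chart model `(B'[IB't])_{(φ(a)t)} ≅ B'[IB'/φ(a)]`
(`stub_certificateRegularStrictTransform`). No definitions are introduced.

References: The Stacks Project, Tag 080C/080E (strict transform = blow-up of the restricted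
centre; its ideal is the exceptional-power torsion); U. Görtz, T. Wedhorn, *Algebraic Geometry I*,
Prop. 13.96 (2). Everything below is folklore.
-/

-- single-problem summit: the doubled namespace component is forced
set_option linter.dupNamespace false

noncomputable section

namespace Summit.ResolutionOfSingularities.ResolutionOfSingularities.Theorems.SectionAscent.CertificateRegular

open MvPolynomial Literature.AlgebraicGeometry.Resolution
open scoped BigOperators

universe u

section Section

variable (K A : Type u) [Field K] [CommRing A] [Algebra K A] (s : ℕ) (B : Type u) [CommRing B]
  (ι : A →+* B) (τ : MvPolynomial (Fin s) K →+* B) (g : Fin s → A)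
  (B' : Type u) [CommRing B'] (q : B →+* B') (hq : Function.Surjective q)
  (hkq : RingHom.ker q = Ideal.span {∑ j : Fin s, τ (X j) * ι (g j)})
  (a : A) {I : Ideal A} (ha : a ∈ I)
  (χ : MvPolynomial (Fin s) (HomogeneousLocalization.Away (reesGrading I) (reesT a ha)) →+*
    blowupAlgebra (I.map ι) (ι a))
  (hχC : ∀ c, χ (C c) = blowupAlgebraMap ι I (I.map ι) a le_rfl (reesChartEquiv a ha c))
  (hχX : ∀ j, χ (X j) = algebraMap B (blowupAlgebra (I.map ι) (ι a)) (τ (X j)))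
  (hχinj : Function.Injective χ)
  (hχgen : ∀ f : blowupAlgebra (I.map ι) (ι a), ∃ σ : MvPolynomial (Fin s) K, σ ≠ 0 ∧ ∃ d,
    f * χ (MvPolynomial.map ((reesChartBase a ha).comp (algebraMap K A)) σ) = χ d)
  (θ : MvPolynomial (Fin s) (HomogeneousLocalization.Away (reesGrading I) (reesT a ha)) →+*
    blowupAlgebra (I.map (q.comp ι)) (q (ι a)))
  (hθ : ∀ d, θ d = blowupAlgebraMap q (I.map ι) (I.map (q.comp ι)) (ι a) (Ideal.map_map ι q).le (χ d))

include hq in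
/-- `B[IB/ι(a)] → B'[IB'/φ(a)]` is surjective. [folklore] -/
theorem blowupAlgebraMap_q_surjective :
    Function.Surjective (blowupAlgebraMap q (I.map ι) (I.map (q.comp ι)) (ι a) (Ideal.map_map ι q).le) :=
  blowupAlgebraMap_surjective _ _ _ _ hq _ (Ideal.map_map ι q).ge

include hq hχgen hθ in
/-- **Generation**: every element of `B'[IB'/φ(a)]` times `θ(σ)`, for some non-zero scalar
`σ ∈ K[t]`, is in the image of `θ`. [folklore] -/
theorem exists_mul_sectionChartMap_eq (e : blowupAlgebra (I.map (q.comp ι)) (q (ι a))) :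
    ∃ σ : MvPolynomial (Fin s) K, σ ≠ 0 ∧ ∃ d,
      e * θ (MvPolynomial.map ((reesChartBase a ha).comp (algebraMap K A)) σ) = θ d := by
  obtain ⟨f, rfl⟩ := blowupAlgebraMap_q_surjective A B ι B' q hq a e
  obtain ⟨σ, hσ, d, h⟩ := hχgen f
  exact ⟨σ, hσ, d, by rw [hθ, hθ, ← map_mul, h]⟩

omit [Algebra K A] in
include hχC hχX in
/-- `χ (ℓ₀) = ℓ/1` for `ℓ₀ = Σ (g_j/1) t_j`. [folklore] -/
theorem chartPolyMap_ell0 :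
    χ (∑ j : Fin s, C (reesChartBase a ha (g j)) * X j) =
      algebraMap B (blowupAlgebra (I.map ι) (ι a)) (∑ j : Fin s, τ (X j) * ι (g j)) := by
  rw [map_sum, map_sum]
  refine Finset.sum_congr rfl fun j _ => ?_
  rw [map_mul, hχC, reesChartEquiv_reesChartBase, blowupAlgebraMap_algebraMap, hχX, ← map_mul,
    mul_comm]

omit [Algebra K A] in
include hkq hχC hχX hθ in
/-- `θ(ℓ₀) = 0`. [folklore] -/
theorem sectionChartMap_ell0 : θ (∑ j : Fin s, C (reesChartBase a ha (g j)) * X j) = 0 := by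
  rw [hθ, chartPolyMap_ell0 K A s B ι τ g a ha χ hχC hχX, blowupAlgebraMap_algebraMap]
  have h0 : q (∑ j : Fin s, τ (X j) * ι (g j)) = 0 := by
    rw [← RingHom.mem_ker, hkq]
    exact Ideal.subset_span rfl
  rw [h0, map_zero]

include hχC hθ in
/-- `θ(a/1) = φ(a)/1` is a non-zero-divisor of `B'[IB'/φ(a)]`. [folklore] -/
theorem sectionChartMap_C_mem_nonZeroDivisors :
    θ (C (reesChartBase a ha a)) ∈ nonZeroDivisors (blowupAlgebra (I.map (q.comp ι)) (q (ι a))) := by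
  rw [hθ, hχC, reesChartEquiv_reesChartBase, blowupAlgebraMap_algebraMap, blowupAlgebraMap_algebraMap]
  exact algebraMap_mem_nonZeroDivisors_blowupAlgebra

include hkq hχC hχX hχinj hχgen hθ in
/-- **The kernel of `θ : (A[It])_{(at)}[t] → B'[IB'/φ(a)]`**: if `θ(d) = 0` then
`(a/1)^N · d · σ = ℓ₀ · d''` for some `N`, `0 ≠ σ ∈ K[t]` and `d''` (the kernel of
`B[IB/ι(a)] → B'[IB'/φ(a)]` is the `ι(a)`-saturation of `(ℓ)`, and `χ` is injective). [folklore] -/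
theorem exists_eq_of_sectionChartMap_eq_zero
    {d : MvPolynomial (Fin s) (HomogeneousLocalization.Away (reesGrading I) (reesT a ha))}
    (hd : θ d = 0) :
    ∃ (N : ℕ) (σ : MvPolynomial (Fin s) K), σ ≠ 0 ∧ ∃ d'',
      C (reesChartBase a ha a) ^ N * d * MvPolynomial.map ((reesChartBase a ha).comp (algebraMap K A)) σ =
        (∑ j : Fin s, C (reesChartBase a ha (g j)) * X j) * d'' := by
  have hker : χ d ∈ RingHom.ker (blowupAlgebraMap q (I.map ι) (I.map (q.comp ι)) (ι a)
      (Ideal.map_map ι q).le) := by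
    rw [RingHom.mem_ker, ← hθ, hd]
  rw [mem_ker_blowupAlgebraMap_iff, hkq] at hker
  obtain ⟨N, hN⟩ := hker
  have hle : (Ideal.span {∑ j : Fin s, τ (X j) * ι (g j)}).map
      (algebraMap B (blowupAlgebra (I.map ι) (ι a))) ≤
        Ideal.span {algebraMap B (blowupAlgebra (I.map ι) (ι a)) (∑ j : Fin s, τ (X j) * ι (g j))} := by
    rw [Ideal.map_le_iff_le_comap, Ideal.span_le, Set.singleton_subset_iff, SetLike.mem_coe,
      Ideal.mem_comap]
    exact Ideal.subset_span rfl
  obtain ⟨f, hf⟩ := Ideal.mem_span_singleton'.mp (hle hN)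
  obtain ⟨σ, hσ, d'', hd''⟩ := hχgen f
  refine ⟨N, σ, hσ, d'', hχinj ?_⟩
  rw [map_mul, map_mul, map_pow, hχC, reesChartEquiv_reesChartBase, blowupAlgebraMap_algebraMap,
    ← hf, map_mul, ← hd'', chartPolyMap_ell0 K A s B ι τ g a ha χ hχC hχX]
  ring

end Section

/-- **Registered form** (`stub_certificateRegularStrictTransform`). In the abstract setting of this
file (`ι : A → B`, `τ : K[t] → B`, `q : B ↠ B'` with kernel `(ℓ)`, `ℓ = Σ τ(t_j) ι(g_j)`, `a ∈ I`,
`χ : (A[It])_{(at)}[t] → B[IB/ι(a)]` injective with the generation property), let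
`θ₀ : (A[It])_{(at)}[t] → (B'[IB't])_{(φ(a)t)}` be the composite of `χ`, the strict-transform map
`B[IB/ι(a)] → B'[IB'/φ(a)]` and the chart identification `B'[IB'/φ(a)] ≅ (B'[IB't])_{(φ(a)t)}`.
Then: (1) every element of `(B'[IB't])_{(φ(a)t)}` times `θ₀(σ)` for some non-zero scalar `σ`
lies in the image of `θ₀`; (2) if `θ₀(d) = 0` then `(a/1)^N d σ = ℓ₀ d''` with `σ ≠ 0`,
`ℓ₀ = Σ (g_j/1) t_j`; (3) `θ₀(ℓ₀) = 0`; (4) `θ₀(a/1)` is a non-zero-divisor.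
[cite: StacksProject, Tag 080E] -/
theorem stub_certificateRegularStrictTransform (K A : Type) [Field K] [CommRing A] [Algebra K A] (s : ℕ) (B : Type) [CommRing B] (ι : A →+* B) (τ : MvPolynomial (Fin s) K →+* B) (g : Fin s → A) (B' : Type) [CommRing B'] (q : B →+* B') (hq : Function.Surjective q) (hkq : RingHom.ker q = Ideal.span {∑ j : Fin s, τ (MvPolynomial.X j) * ι (g j)}) (I : Ideal A) (a : A) (ha : a ∈ I) (χ : MvPolynomial (Fin s) (HomogeneousLocalization.Away (Literature.AlgebraicGeometry.Resolution.reesGrading I) (Literature.AlgebraicGeometry.Resolution.reesT a ha)) →+* Literature.AlgebraicGeometry.Resolution.blowupAlgebra (I.map ι) (ι a)) (hχC : ∀ c, χ (MvPolynomial.C c) = Literature.AlgebraicGeometry.Resolution.blowupAlgebraMap ι I (I.map ι) a le_rfl (Literature.AlgebraicGeometry.Resolution.reesChartEquiv a ha c)) (hχX : ∀ j, χ (MvPolynomial.X j) = algebraMap B (Literature.AlgebraicGeometry.Resolution.blowupAlgebra (I.map ι) (ι a)) (τ (MvPolynomial.X j))) (hχinj : Function.Injective χ) (hχgen : ∀ f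 : Literature.AlgebraicGeometry.Resolution.blowupAlgebra (I.map ι) (ι a), ∃ σ : MvPolynomial (Fin s) K, σ ≠ 0 ∧ ∃ d, f * χ (MvPolynomial.map ((Literature.AlgebraicGeometry.Resolution.reesChartBase a ha).comp (algebraMap K A)) σ) = χ d) (hmem : q (ι a) ∈ I.map (q.comp ι)) (θ₀ : MvPolynomial (Fin s) (HomogeneousLocalization.Away (Literature.AlgebraicGeometry.Resolution.reesGrading I) (Literature.AlgebraicGeometry.Resolution.reesT a ha)) →+* HomogeneousLocalization.Away (Literature.AlgebraicGeometry.Resolution.reesGrading (I.map (q.comp ι))) (Literature.AlgebraicGeometry.Resolution.reesT (q (ι a)) hmem)) (hθ₀ : ∀ d, θ₀ d = (Literature.AlgebraicGeometry.Resolution.reesChartEquiv (q (ι a)) hmem).symm (Literature.AlgebraicGeometry.Resolution.blowupAlgebraMap q (I.map ι) (I.map (q.comp ι)) (ι a) (Ideal.map_map ι q).le (χ d))) : (∀ e, ∃ σ : MvPolynomial (Fin s) K, σ ≠ 0 ∧ ∃ d, e * θ₀ (MvPolynomial.map ((Literature.AlgebraicGeometry.Resolution.reesChartBase a ha).comp (algebraMap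 K A)) σ) = θ₀ d) ∧ (∀ d, θ₀ d = 0 → ∃ (N : ℕ) (σ : MvPolynomial (Fin s) K), σ ≠ 0 ∧ ∃ d'', MvPolynomial.C (Literature.AlgebraicGeometry.Resolution.reesChartBase a ha a) ^ N * d * MvPolynomial.map ((Literature.AlgebraicGeometry.Resolution.reesChartBase a ha).comp (algebraMap K A)) σ = (∑ j : Fin s, MvPolynomial.C (Literature.AlgebraicGeometry.Resolution.reesChartBase a ha (g j)) * MvPolynomial.X j) * d'') ∧ θ₀ (∑ j : Fin s, MvPolynomial.C (Literature.AlgebraicGeometry.Resolution.reesChartBase a ha (g j)) * MvPolynomial.X j) = 0 ∧ θ₀ (MvPolynomial.C (Literature.AlgebraicGeometry.Resolution.reesChartBase a ha a)) ∈ nonZeroDivisors (HomogeneousLocalization.Away (Literature.AlgebraicGeometry.Resolution.reesGrading (I.map (q.comp ι))) (Literature.AlgebraicGeometry.Resolution.reesT (q (ι a)) hmem)) := by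
  set e := reesChartEquiv (q (ι a)) hmem
  set θ : MvPolynomial (Fin s) (HomogeneousLocalization.Away (reesGrading I) (reesT a ha)) →+*
      blowupAlgebra (I.map (q.comp ι)) (q (ι a)) :=
    (blowupAlgebraMap q (I.map ι) (I.map (q.comp ι)) (ι a) (Ideal.map_map ι q).le).comp χ
  have hθ : ∀ d, θ d = blowupAlgebraMap q (I.map ι) (I.map (q.comp ι)) (ι a)
      (Ideal.map_map ι q).le (χ d) := fun d => rfl
  have hθ₀' : ∀ d, θ₀ d = e.symm (θ d) := fun d => by rw [hθ₀, hθ]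
  refine ⟨?_, ?_, ?_, ?_⟩
  · intro x
    obtain ⟨σ, hσ, d, h⟩ :=
      exists_mul_sectionChartMap_eq K A s B ι B' q hq a ha χ hχgen θ hθ (e x)
    refine ⟨σ, hσ, d, e.injective ?_⟩
    rw [map_mul, hθ₀', hθ₀', RingEquiv.apply_symm_apply, RingEquiv.apply_symm_apply, h]
  · intro d hd
    have hd' : θ d = 0 := by
      apply e.symm.injective
      rw [← hθ₀', hd, map_zero]
    exact exists_eq_of_sectionChartMap_eq_zero K A s B ι τ g B' q hkq a ha χ hχC hχX hχinj hχgen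
      θ hθ hd'
  · rw [hθ₀', sectionChartMap_ell0 K A s B ι τ g B' q hkq a ha χ hχC hχX θ hθ, map_zero]
  · have hx := sectionChartMap_C_mem_nonZeroDivisors A s B ι B' q a ha χ hχC θ hθ
    have hfx : e.toRingHom (θ₀ (MvPolynomial.C (reesChartBase a ha a))) =
        θ (MvPolynomial.C (reesChartBase a ha a)) := by
      change e _ = _
      rw [hθ₀', RingEquiv.apply_symm_apply]
    rw [← hfx] at hx
    exact mem_nonZeroDivisors_of_injective (f := e.toRingHom) e.injective hx

end Summit.ResolutionOfSingularities.ResolutionOfSingularities.Theorems.SectionAscent.CertificateRegular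

end
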